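import Literature.AlgebraicGeometry.AbelianSchemes.HomEqualityLocusFamily
import Literature.AlgebraicGeometry.Morphisms.SectionEqualityLocus
import Literature.AlgebraicGeometry.AbelianSchemes.AbelianSchemeDualIsogenyHom
import Literature.AlgebraicGeometry.AbelianSchemes.AbelianSchemeHomExtSchematicallyDominant
import Literature.AlgebraicGeometry.AbelianSchemes.AbelianSchemeOverHomNoetherianAnyBase
import Literature.AlgebraicGeometry.AbelianSchemes.AbelianSchemeOverLevelBaseChange
import HarnessLib

/-!
# The CONDITIONS LOCUS of a pair of morphisms between two PEL tuples: «`(U, V)` is an isomorphism of tuples» is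
# represented by a quasi-compact finite-type subscheme of the base

Topic `AlgebraicGeometry/AbelianSchemes`; namespace `Literature.AlgebraicGeometry.AbelianSchemes.AbelianSchemeOver`.
THEOREMS ONLY (no def, no instance, no notation, no named fact, no `sorry`).  Cell hodgecm-mathlib (D-0151), P6 «MOD programme»,
SPREAD door, SP3-a2 line `Lines/F0_P6a_IsomSchemeFiniteType.lean` (A-p14 (g34)), organ **(O-C)** of `stub_ICON` (A-p13 (g37),
2026-09-01; division A-p14 (g34) 23:18:18Z ∕ 23:20:32Z).  HC_CM is proved only modulo the printed citations until rung 0 closes;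
nothing here is about HC.

THE MATHEMATICS ([MumfordFogartyKirwan1994] Ch. 7 §2, proof of Prop. 7.3 ∕ Thm. 7.9; [Kottwitz1992] §5 p. 390: the PEL conditions are
«closed», indeed open and closed, in the Hom-scheme).  Over a locally Noetherian base `B` with Noetherian underlying space let
`(Bᵢ, λᵢ : Bᵢ → B̂ᵢ, (B̂ᵢ, 𝒫ᵢ), lvlᵢ, ιᵢ : O → End Bᵢ)` (`i = 1, 2`) be two tuples (abelian scheme, homomorphism to a dual pair
normalised along `Bᵢ × {ε}`, level-`n` structure, endomorphism family of homomorphisms) and let `U : B₁ → B₂`, `V : B₂ → B₁` be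
ARBITRARY `B`-morphisms (the universal morphisms of two Hom-scheme pieces).  The sub-functor of `B` «after base change along
`u : T → B`, `U_T` is an ISOMORPHISM OF TUPLES with inverse `V_T`» — `U_T` a homomorphism with `U_T V_T = 1 = V_T U_T`,
`U_T ≫ λ₂ ≫ U_T^∨ = λ₁` (dual-homomorphism form, ★ `DualPair.dualIsogenyOver`), `σ₁ᵢ ≫ U_T = σ₂ᵢ`, `ι₁(a) ≫ U_T = U_T ≫ ι₂(a)` — is
represented by a subscheme `m : I → B`, quasi-compact and locally of finite type over `B` (`exists_conditionsLocus`).  Construction: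
* the CLOSED layer `E₀ ↪ B` (★ `Morphisms.exists_isClosedImmersion_forall_comp_eq_iff`, any family of SECTION equalities):
  `ε ≫ U = ε`, `ε ≫ V = ε`, `σ₁ᵢ ≫ U = σ₂ᵢ`;
* the NORMALISATIONS `Ũ := U · (U ∘ ε ∘ π)⁻¹`, `Ṽ` (translate by the image of the unit section; pointwise group structure on
  `Hom_B(B₁, B₂)`): `Ũ` preserves the unit section, hence IS A HOMOMORPHISM over `B` by rigidity over any locally Noetherian base (★
  `isMonHom_of_one_comp_of_isLocallyNoetherian_base`, [MumfordFogartyKirwan1994] Cor. 6.4), so is `Ũ^∨` (★ `one_comp_dualIsogenyOver`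
  under the unit hypotheses), and `Ũ_T = U_T` wherever `ε ≫ U_T = ε`;
* the OPEN-AND-CLOSED layer `W ⊆ B` (★ `HomEqualityLocusClosed` ∕ ★ `HomEqualityLocusFamily`: equalities of HOMOMORPHISMS of abelian
  schemes are open and closed, any family on a Noetherian space): `Ũ Ṽ = 1`, `Ṽ Ũ = 1`, `Ũ ≫ λ₂ ≫ Ũ^∨ = λ₁`, `ι₁(a) ≫ Ũ = Ũ ≫ ι₂(a)`
  (`a ∈ O`);
* `I := E₀ ∩ W` (the open `ι₀⁻¹ W` of `E₀`); the readings at `u` use `Ũ_T = U_T` on `E₀` and ★ `baseChangeHom_dualIsogenyOver`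
  (`(Ũ^∨)_T = (Ũ_T)^∨`).
The functor-of-points statement is given for every locally Noetherian `T` (Mumford's test category); at a geometric point
`Spec Ω → B` it is the input of ★ `exists_tupleRel_baseChange_comp_of_iso₂` (`TupleIsoPointCriteria`).

## References
* [MumfordFogartyKirwan1994] D. Mumford, J. Fogarty, F. Kirwan, *Geometric Invariant Theory*, 3rd ed. (1994), Ch. 6 §1 Cor. 6.2,
  Cor. 6.4 (pp. 116–117); Ch. 7 §2 Def. 7.2–7.3 (pp. 129–130), Prop. 7.3 (p. 132).
* [Kottwitz1992] R. Kottwitz, *Points on some Shimura varieties over finite fields*, JAMS 5 (1992), §5 (p. 390).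
* [GortzWedhorn2020] U. Görtz, T. Wedhorn, *Algebraic Geometry I*, 2nd ed. (2020), Section (4.7) (pp. 107–108), Def. 9.7.
-/

set_option autoImplicit false

noncomputable section

-- Mathlib's `Over`/pull-back API is stated across semireducible wrappers (as in the ★ `AbelianSchemes/*` files).
set_option backward.isDefEq.respectTransparency false

universe u

open CategoryTheory CategoryTheory.Limits AlgebraicGeometry MonoidalCategory CartesianMonoidalCategory TopologicalSpace
open scoped MonObj CategoryTheory.Obj

namespace Literature.AlgebraicGeometry.AbelianSchemes

namespace AbelianSchemeOver

/-! ### §1 Normalising a morphism of abelian schemes by the image of the unit section -/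

section Normalize

variable {B : Scheme.{u}} {B₁ B₂ : AbelianSchemeOver B} (U : B₁.X ⟶ B₂.X)

/-- **The normalisation `Ũ := U · (𝟣 ≫ U)⁻¹` preserves the unit section** (`𝟣 : B₁ → B₁` the constant-unit endomorphism
`x ↦ ε`, so `𝟣 ≫ U` is the constant morphism `x ↦ U(ε)`; pointwise group structure on `Hom_B(B₁, B₂)`): `ε ≫ Ũ = U(ε) · U(ε)⁻¹ = ε`.
[cite: MumfordFogartyKirwan1994, Ch. 6 §1 Corollary 6.4 (p. 117)] -/
theorem one_comp_mul_inv_one_comp : η[B₁.X] ≫ (U * ((1 : B₁.X ⟶ B₁.X) ≫ U)⁻¹) = η[B₂.X] := by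
  rw [MonObj.comp_mul, GrpObj.comp_inv, ← Category.assoc, MonObj.comp_one, ← MonObj.one_eq_one, mul_inv_cancel,
    ← MonObj.one_eq_one]

/-- **`Ũ` is a homomorphism** over any locally Noetherian base: a unit-preserving morphism of abelian schemes is a homomorphism
(rigidity, ★ `isMonHom_of_one_comp_of_isLocallyNoetherian_base`). [cite: MumfordFogartyKirwan1994, Ch. 6 §1 Corollary 6.4 (p. 117)] -/
theorem isMonHom_mul_inv_one_comp [IsLocallyNoetherian B] : IsMonHom (U * ((1 : B₁.X ⟶ B₁.X) ≫ U)⁻¹) :=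
  isMonHom_of_one_comp_of_isLocallyNoetherian_base _ (one_comp_mul_inv_one_comp U)

/-- **`Ũ_T = U_T` wherever `U_T` preserves the unit section**: base change is a group homomorphism on `Hom(B₁, B₂)` (Mathlib
`Functor.map_mul`, `Functor.map_inv'`) and `(𝟣 ≫ U)_T = 𝟣 ≫ U_T = (x ↦ U_T(ε)) = (x ↦ ε) = 1`.
[cite: GortzWedhorn2020, Section (4.7) (pp. 107–108)] [cite: MumfordFogartyKirwan1994, Ch. 6 §1 Corollary 6.4 (p. 117)] -/
theorem baseChangeHom_mul_inv_one_comp_eq {T : Scheme.{u}} (u : T ⟶ B)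
    (hunit : η[(B₁.baseChange u).X] ≫ baseChangeHom U u = η[(B₂.baseChange u).X]) :
    baseChangeHom (U * ((1 : B₁.X ⟶ B₁.X) ≫ U)⁻¹) u = baseChangeHom U u := by
  have h1 : baseChangeHom ((1 : B₁.X ⟶ B₁.X) ≫ U) u = (1 : (B₁.baseChange u).X ⟶ (B₂.baseChange u).X) := by
    change (Over.pullback u).map ((1 : B₁.X ⟶ B₁.X) ≫ U) = _
    rw [Functor.map_comp, Functor.map_one, Hom.one_def, Category.assoc]
    change toUnit _ ≫ η[(B₁.baseChange u).X] ≫ baseChangeHom U u = _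
    rw [hunit, ← Hom.one_def]
  change (Over.pullback u).map (U * ((1 : B₁.X ⟶ B₁.X) ≫ U)⁻¹) = (Over.pullback u).map U
  rw [Functor.map_mul, Functor.map_inv']
  change baseChangeHom U u * (baseChangeHom ((1 : B₁.X ⟶ B₁.X) ≫ U) u)⁻¹ = baseChangeHom U u
  rw [h1, inv_one, mul_one]

/-- `dualIsogenyOver` does not depend on the homomorphism witness and respects equality of the morphism (non-Prop plumbing for
rewriting under the instance argument). [cite: MumfordAV1970, §15 Thm. 1 (p. 143)] -/
theorem dualIsogenyOver_congr_left {ψ₁ ψ₂ : B₁.X ⟶ B₂.X} {h₁ : IsMonHom ψ₁} {h₂ : IsMonHom ψ₂} (h : ψ₁ = ψ₂)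
    (D₁ : B₁.DualPair) (D₂ : B₂.DualPair) :
    @DualPair.dualIsogenyOver B B₁ B₂ ψ₁ h₁ D₁ D₂ = @DualPair.dualIsogenyOver B B₁ B₂ ψ₂ h₂ D₁ D₂ := by
  subst h
  rfl

/-! ### §2 Reading SECTION equalities after base change -/

section Sections

variable {T : Scheme.{u}} (u : T ⟶ B)

/-- **A pulled-back section `τ₁ ×_B T` is carried by `U_T` to `τ₂ ×_B T` iff `u ≫ (τ₁ ≫ U) = u ≫ τ₂` on underlying schemes** — a
section of `B₂ ×_B T → T` is determined by its composite with the projection to `B₂` (★ `sectionBaseChange_left_comp_fst`,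
★ `baseChangeHom_left_comp_fst`).  This is the currency of ★ `Morphisms.exists_isClosedImmersion_forall_comp_eq_iff`.
[cite: MumfordFogartyKirwan1994, Ch. 7 §2 Definition 7.2 (p. 129)] [cite: GortzWedhorn2020, Section (4.7) (pp. 107–108)] -/
theorem sectionBaseChange_comp_baseChangeHom_eq_iff (τ₁ : B₁.Sections) (τ₂ : B₂.Sections) :
    B₁.sectionBaseChange u τ₁ ≫ baseChangeHom U u = B₂.sectionBaseChange u τ₂ ↔ u ≫ (τ₁ ≫ U).left = u ≫ τ₂.left := by
  have k₁ : (B₁.sectionBaseChange u τ₁ ≫ baseChangeHom U u).left ≫ pullback.fst B₂.X.hom u = u ≫ (τ₁ ≫ U).left := by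
    rw [Over.comp_left, Category.assoc, baseChangeHom_left_comp_fst, ← Category.assoc, sectionBaseChange_left_comp_fst,
      Category.assoc, Over.comp_left]
  have k₂ : (B₂.sectionBaseChange u τ₂).left ≫ pullback.fst B₂.X.hom u = u ≫ τ₂.left :=
    B₂.sectionBaseChange_left_comp_fst u τ₂
  constructor
  · intro h
    rw [← k₁, ← k₂, h]
  · intro h
    ext
    apply pullback.hom_ext
    · rw [k₁, k₂, h]
    · exact (Over.w (B₁.sectionBaseChange u τ₁ ≫ baseChangeHom U u)).trans (Over.w (B₂.sectionBaseChange u τ₂)).symm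

/-- **`U_T` preserves the unit section iff `u ≫ (ε ≫ U) = u ≫ ε`** (the unit section pulls back to the unit section, ★
`sectionBaseChange_one_eq_η`). [cite: MumfordFogartyKirwan1994, Ch. 6 §1 Corollary 6.4 (p. 117)] -/
theorem one_comp_baseChangeHom_iff :
    η[(B₁.baseChange u).X] ≫ baseChangeHom U u = η[(B₂.baseChange u).X] ↔ u ≫ (η[B₁.X] ≫ U).left = u ≫ η[B₂.X].left := by
  rw [← sectionBaseChange_one_eq_η, ← sectionBaseChange_one_eq_η]
  exact sectionBaseChange_comp_baseChangeHom_eq_iff U u _ _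

/-- **`U_T` carries the pulled-back level sections of `B₁` to those of `B₂` iff `u ≫ (σ₁ᵢ ≫ U) = u ≫ σ₂ᵢ` for all `i`** (★
`LevelStructure.baseChange_σ`). [cite: MumfordFogartyKirwan1994, Ch. 7 §2 Definition 7.2 (p. 129)] -/
theorem baseChange_σ_comp_baseChangeHom_iff {g n : ℕ} (lvl₁ : B₁.LevelStructure g n) (lvl₂ : B₂.LevelStructure g n)
    (i : Fin g ⊕ Fin g) :
    (lvl₁.baseChange u).σ i ≫ baseChangeHom U u = (lvl₂.baseChange u).σ i ↔ u ≫ (lvl₁.σ i ≫ U).left = u ≫ (lvl₂.σ i).left := by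
  rw [LevelStructure.baseChange_σ, LevelStructure.baseChange_σ]
  exact sectionBaseChange_comp_baseChangeHom_eq_iff U u _ _

/-- **If `U_T` preserves the unit section it is a homomorphism** (`T` locally Noetherian; rigidity ★
`isMonHom_of_one_comp_of_isLocallyNoetherian_base`). [cite: MumfordFogartyKirwan1994, Ch. 6 §1 Corollary 6.4 (p. 117)] -/
theorem isMonHom_baseChangeHom_of_comp_eq [IsLocallyNoetherian T] (h : u ≫ (η[B₁.X] ≫ U).left = u ≫ η[B₂.X].left) :
    IsMonHom (baseChangeHom U u) :=
  isMonHom_of_one_comp_of_isLocallyNoetherian_base _ ((one_comp_baseChangeHom_iff U u).2 h)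

end Sections

end Normalize

/-! ### §3 THE CONDITIONS LOCUS -/

section Locus

variable {B : Scheme.{u}} [IsLocallyNoetherian B] [NoetherianSpace B] (B₁ B₂ : AbelianSchemeOver B)
  (D₁ : B₁.DualPair) (D₂ : B₂.DualPair)
  (hD₁ : Nonempty ((Scheme.Modules.pullback (DualPair.unitHatSlice D₁)).obj D₁.P ≅ SheafOfModules.unit _))
  (hD₂ : Nonempty ((Scheme.Modules.pullback (DualPair.unitHatSlice D₂)).obj D₂.P ≅ SheafOfModules.unit _))
  (lam₁ : B₁.X ⟶ D₁.hat.X) (lam₂ : B₂.X ⟶ D₂.hat.X) [IsMonHom lam₁] [IsMonHom lam₂]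
  {g n : ℕ} (lvl₁ : B₁.LevelStructure g n) (lvl₂ : B₂.LevelStructure g n)
  {O : Type*} (act₁ : O → (B₁.X ⟶ B₁.X)) (act₂ : O → (B₂.X ⟶ B₂.X)) [∀ a, IsMonHom (act₁ a)] [∀ a, IsMonHom (act₂ a)]
  (U : B₁.X ⟶ B₂.X) (V : B₂.X ⟶ B₁.X)

include hD₁ hD₂ in
/-- **THE CONDITIONS LOCUS.**  Let `B` be a locally Noetherian scheme with Noetherian underlying space, and over `B`: abelian schemes
`B₁, B₂`; dual pairs `(B̂ᵢ, 𝒫ᵢ)` normalised along `Bᵢ × {ε}` (`hDᵢ`, e.g. from polarisations over a reduced base by ★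
`Polarization.nonempty_unitHatSlice_iso` and ★ `nonempty_unitHatSlice_baseChange_iso`); homomorphisms `λᵢ : Bᵢ → B̂ᵢ`; level-`n`
structures `lvlᵢ`; families `ιᵢ : O → End(Bᵢ)` of homomorphisms; and two ARBITRARY `B`-morphisms `U : B₁ → B₂`, `V : B₂ → B₁`.
Then there is a `B`-scheme `m : I → B`, QUASI-COMPACT and LOCALLY OF FINITE TYPE (an open of a closed subscheme of `B`), such that
for every locally Noetherian `T` and `u : T → B`:  `u` factors through `I` iff, after base change along `u`, `U_T` is an ISOMORPHISM
OF TUPLES with inverse `V_T` — an isomorphism of `T`-group schemes `ε` with `ε = U_T`, `ε⁻¹ = V_T`, EXACT on the polarisations in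
dual-homomorphism form `ε ≫ λ₂ ≫ ε^∨ = λ₁`, carrying the level sections `σ₁ᵢ ≫ ε = σ₂ᵢ` and commuting with the actions
`ι₁(a) ≫ ε = ε ≫ ι₂(a)` (= the input of ★ `exists_tupleRel_baseChange_comp_of_iso₂` at `T = Spec Ω`).  ROAD: closed layer of section
equalities (★ `Morphisms.exists_isClosedImmersion_forall_comp_eq_iff`: `ε ≫ U = ε`, `ε ≫ V = ε`, `σ₁ᵢ ≫ U = σ₂ᵢ`) ∩ open-and-closed
layer of homomorphism equalities for the NORMALISATIONS `Ũ, Ṽ` (§1; ★ `HomEqualityLocusClosed`, ★ `HomEqualityLocusFamily`: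
`ŨṼ = 1`, `ṼŨ = 1`, `Ũ ≫ λ₂ ≫ Ũ^∨ = λ₁`, `ι₁(a) ≫ Ũ = Ũ ≫ ι₂(a)`), read at `u` through `Ũ_T = U_T` on the closed layer and ★
`baseChangeHom_dualIsogenyOver`. [cite: MumfordFogartyKirwan1994, Ch. 7 §2 Proposition 7.3 (p. 132) and Ch. 6 §1 Corollary 6.4 (p. 117)]
[cite: Kottwitz1992, §5 (p. 390)] -/
theorem exists_conditionsLocus :
    ∃ (I : Scheme.{u}) (m : I ⟶ B) (_ : QuasiCompact m) (_ : LocallyOfFiniteType m),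
      ∀ ⦃T : Scheme.{u}⦄ [IsLocallyNoetherian T] (u : T ⟶ B),
        (∃ l : T ⟶ I, l ≫ m = u) ↔
          ∃ (ε : (B₁.baseChange u).X ≅ (B₂.baseChange u).X) (_ : IsMonHom ε.hom),
            ε.hom = baseChangeHom U u ∧ ε.inv = baseChangeHom V u ∧
            ε.hom ≫ baseChangeHom lam₂ u ≫ DualPair.dualIsogenyOver ε.hom (D₁.baseChange u) (D₂.baseChange u) =
              baseChangeHom lam₁ u ∧
            (∀ i, (lvl₁.baseChange u).σ i ≫ ε.hom = (lvl₂.baseChange u).σ i) ∧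
            ∀ a, baseChangeHom (act₁ a) u ≫ ε.hom = ε.hom ≫ baseChangeHom (act₂ a) u := by
  classical
  haveI := B₁.isProper
  haveI := B₂.isProper
  -- §1: the normalisations `Ũ`, `Ṽ` are homomorphisms over `B`, and so is `Ũ^∨`
  haveI hUn : IsMonHom (U * ((1 : B₁.X ⟶ B₁.X) ≫ U)⁻¹) := isMonHom_mul_inv_one_comp U
  haveI hVn : IsMonHom (V * ((1 : B₂.X ⟶ B₂.X) ≫ V)⁻¹) := isMonHom_mul_inv_one_comp V
  haveI hUnd : IsMonHom (DualPair.dualIsogenyOver (U * ((1 : B₁.X ⟶ B₁.X) ≫ U)⁻¹) D₁ D₂) :=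
    isMonHom_of_one_comp_of_isLocallyNoetherian_base _ (DualPair.one_comp_dualIsogenyOver _ D₁ D₂ hD₂ hD₁)
  -- the CLOSED layer: unit sections and level sections
  let X₀ : Option (Option (Fin g ⊕ Fin g)) → Over B := fun k => k.elim B₁.X fun _ => B₂.X
  let σ₀ : ∀ k, 𝟙_ (Over B) ⟶ X₀ k := fun k =>
    match k with
    | none => η[B₂.X] ≫ V
    | some none => η[B₁.X] ≫ U
    | some (some i) => lvl₁.σ i ≫ U
  let σ₀' : ∀ k, 𝟙_ (Over B) ⟶ X₀ k := fun k =>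
    match k with
    | none => η[B₁.X]
    | some none => η[B₂.X]
    | some (some i) => lvl₂.σ i
  haveI : ∀ k, IsSeparated (X₀ k).hom := by
    rintro (_ | _ | _) <;> dsimp only [X₀, Option.elim] <;> infer_instance
  obtain ⟨E₀, ι₀, hι₀, hE₀⟩ := Morphisms.exists_isClosedImmersion_forall_comp_eq_iff X₀ σ₀ σ₀'
  haveI := hι₀
  -- the OPEN-AND-CLOSED layer: four families of homomorphism equalities on `B`
  obtain ⟨W₁, hW₁c, hW₁⟩ := exists_opens_isClosed_forall_pullback_map_eq_iff
    ((U * ((1 : B₁.X ⟶ B₁.X) ≫ U)⁻¹) ≫ (V * ((1 : B₂.X ⟶ B₂.X) ≫ V)⁻¹)) (𝟙 B₁.X)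
  obtain ⟨W₂, hW₂c, hW₂⟩ := exists_opens_isClosed_forall_pullback_map_eq_iff
    ((V * ((1 : B₂.X ⟶ B₂.X) ≫ V)⁻¹) ≫ (U * ((1 : B₁.X ⟶ B₁.X) ≫ U)⁻¹)) (𝟙 B₂.X)
  obtain ⟨W₃, hW₃c, hW₃⟩ := exists_opens_isClopen_forall_iff_of_noetherianSpace (fun _ : O => B₁) (fun _ : O => B₂)
    (fun a => act₁ a ≫ (U * ((1 : B₁.X ⟶ B₁.X) ≫ U)⁻¹)) (fun a => (U * ((1 : B₁.X ⟶ B₁.X) ≫ U)⁻¹) ≫ act₂ a)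
  obtain ⟨W₄, hW₄c, hW₄⟩ := exists_opens_isClosed_forall_pullback_map_eq_iff
    ((U * ((1 : B₁.X ⟶ B₁.X) ≫ U)⁻¹) ≫ lam₂ ≫ DualPair.dualIsogenyOver (U * ((1 : B₁.X ⟶ B₁.X) ≫ U)⁻¹) D₁ D₂) lam₁
  let W : B.Opens := W₁ ⊓ W₂ ⊓ W₃ ⊓ W₄
  -- the locus: the open `ι₀⁻¹ W` of the closed `E₀`
  haveI : IsLocallyNoetherian E₀ := LocallyOfFiniteType.isLocallyNoetherian ι₀
  refine ⟨↑(ι₀ ⁻¹ᵁ W), (ι₀ ⁻¹ᵁ W).ι ≫ ι₀, inferInstance, inferInstance, fun T _ u => ?_⟩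
  constructor
  · -- (→) a `T`-point of the locus gives an isomorphism of tuples
    rintro ⟨l, rfl⟩
    have hsec := (hE₀ ((l ≫ (ι₀ ⁻¹ᵁ W).ι) ≫ ι₀)).2 ⟨l ≫ (ι₀ ⁻¹ᵁ W).ι, rfl⟩
    have hrange : Set.range ((l ≫ (ι₀ ⁻¹ᵁ W).ι) ≫ ι₀).base ⊆ (W : Set B) := by
      rintro _ ⟨t, rfl⟩
      have ht : (ι₀ ⁻¹ᵁ W).ι.base (l.base t) ∈ ((ι₀ ⁻¹ᵁ W : E₀.Opens) : Set E₀) := by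
        rw [← Scheme.Opens.range_ι]
        exact ⟨_, rfl⟩
      exact ht
    set u := (l ≫ (ι₀ ⁻¹ᵁ W).ι) ≫ ι₀ with hu
    have hW₁u := (hW₁ u).2 (hrange.trans fun x hx => hx.1.1.1)
    have hW₂u := (hW₂ u).2 (hrange.trans fun x hx => hx.1.1.2)
    have hW₃u := (hW₃ u).2 (hrange.trans fun x hx => hx.1.2)
    have hW₄u := (hW₄ u).2 (hrange.trans fun x hx => hx.2)
    -- on the closed layer `Ũ_T = U_T`, `Ṽ_T = V_T`, and `U_T` is a homomorphism
    have hunitU : u ≫ (η[B₁.X] ≫ U).left = u ≫ η[B₂.X].left := hsec (some none)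
    have hunitV : u ≫ (η[B₂.X] ≫ V).left = u ≫ η[B₁.X].left := hsec none
    have hUnu : baseChangeHom (U * ((1 : B₁.X ⟶ B₁.X) ≫ U)⁻¹) u = baseChangeHom U u :=
      baseChangeHom_mul_inv_one_comp_eq U u ((one_comp_baseChangeHom_iff U u).2 hunitU)
    have hVnu : baseChangeHom (V * ((1 : B₂.X ⟶ B₂.X) ≫ V)⁻¹) u = baseChangeHom V u :=
      baseChangeHom_mul_inv_one_comp_eq V u ((one_comp_baseChangeHom_iff V u).2 hunitV)
    haveI hUu : IsMonHom (baseChangeHom U u) := isMonHom_baseChangeHom_of_comp_eq U u hunitU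
    -- the isomorphism `ε := (U_T, V_T)`
    have h₁ : baseChangeHom U u ≫ baseChangeHom V u = 𝟙 _ := by
      have h := hW₁u
      change baseChangeHom _ u = baseChangeHom (𝟙 B₁.X) u at h
      rw [show baseChangeHom ((U * ((1 : B₁.X ⟶ B₁.X) ≫ U)⁻¹) ≫ (V * ((1 : B₂.X ⟶ B₂.X) ≫ V)⁻¹)) u =
          baseChangeHom (U * ((1 : B₁.X ⟶ B₁.X) ≫ U)⁻¹) u ≫ baseChangeHom (V * ((1 : B₂.X ⟶ B₂.X) ≫ V)⁻¹) u from
          Functor.map_comp _ _ _, hUnu, hVnu] at h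
      rw [h]
      exact (Over.pullback u).map_id _
    have h₂ : baseChangeHom V u ≫ baseChangeHom U u = 𝟙 _ := by
      have h := hW₂u
      change baseChangeHom _ u = baseChangeHom (𝟙 B₂.X) u at h
      rw [show baseChangeHom ((V * ((1 : B₂.X ⟶ B₂.X) ≫ V)⁻¹) ≫ (U * ((1 : B₁.X ⟶ B₁.X) ≫ U)⁻¹)) u =
          baseChangeHom (V * ((1 : B₂.X ⟶ B₂.X) ≫ V)⁻¹) u ≫ baseChangeHom (U * ((1 : B₁.X ⟶ B₁.X) ≫ U)⁻¹) u from
          Functor.map_comp _ _ _, hUnu, hVnu] at h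
      rw [h]
      exact (Over.pullback u).map_id _
    let ε : (B₁.baseChange u).X ≅ (B₂.baseChange u).X := ⟨baseChangeHom U u, baseChangeHom V u, h₁, h₂⟩
    refine ⟨ε, hUu, rfl, rfl, ?_, fun i => ?_, fun a => ?_⟩
    · -- `λ`: read `Ũ ≫ λ₂ ≫ Ũ^∨ = λ₁` at `u` through `(Ũ^∨)_T = (Ũ_T)^∨` and `Ũ_T = U_T`
      have h := hW₄u
      change baseChangeHom _ u = baseChangeHom lam₁ u at h
      rw [show baseChangeHom ((U * ((1 : B₁.X ⟶ B₁.X) ≫ U)⁻¹) ≫ lam₂ ≫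
            DualPair.dualIsogenyOver (U * ((1 : B₁.X ⟶ B₁.X) ≫ U)⁻¹) D₁ D₂) u =
          baseChangeHom (U * ((1 : B₁.X ⟶ B₁.X) ≫ U)⁻¹) u ≫ baseChangeHom lam₂ u ≫
            baseChangeHom (DualPair.dualIsogenyOver (U * ((1 : B₁.X ⟶ B₁.X) ≫ U)⁻¹) D₁ D₂) u by
          change (Over.pullback u).map _ = _
          rw [Functor.map_comp, Functor.map_comp],
        baseChangeHom_dualIsogenyOver u _ D₁ D₂, dualIsogenyOver_congr_left (h₂ := hUu) hUnu, hUnu] at h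
      exact h
    · exact (baseChange_σ_comp_baseChangeHom_iff U u lvl₁ lvl₂ i).2 (hsec (some (some i)))
    · have h := hW₃u a
      change baseChangeHom (act₁ a ≫ _) u = baseChangeHom (_ ≫ act₂ a) u at h
      rw [show baseChangeHom (act₁ a ≫ (U * ((1 : B₁.X ⟶ B₁.X) ≫ U)⁻¹)) u =
          baseChangeHom (act₁ a) u ≫ baseChangeHom (U * ((1 : B₁.X ⟶ B₁.X) ≫ U)⁻¹) u from Functor.map_comp _ _ _,
        show baseChangeHom ((U * ((1 : B₁.X ⟶ B₁.X) ≫ U)⁻¹) ≫ act₂ a) u =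
          baseChangeHom (U * ((1 : B₁.X ⟶ B₁.X) ≫ U)⁻¹) u ≫ baseChangeHom (act₂ a) u from Functor.map_comp _ _ _,
        hUnu] at h
      exact h
  · -- (←) an isomorphism of tuples gives a `T`-point of the locus
    rintro ⟨ε, hε, hεU, hεV, hlam, hσ, hact⟩
    haveI hUu : IsMonHom (baseChangeHom U u) := hεU ▸ hε
    haveI hVu : IsMonHom (baseChangeHom V u) := hεV ▸ (inferInstance : IsMonHom ε.inv)
    have hunitU : u ≫ (η[B₁.X] ≫ U).left = u ≫ η[B₂.X].left :=
      (one_comp_baseChangeHom_iff U u).1 (IsMonHom.one_hom (baseChangeHom U u))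
    have hunitV : u ≫ (η[B₂.X] ≫ V).left = u ≫ η[B₁.X].left :=
      (one_comp_baseChangeHom_iff V u).1 (IsMonHom.one_hom (baseChangeHom V u))
    have hUnu : baseChangeHom (U * ((1 : B₁.X ⟶ B₁.X) ≫ U)⁻¹) u = baseChangeHom U u :=
      baseChangeHom_mul_inv_one_comp_eq U u ((one_comp_baseChangeHom_iff U u).2 hunitU)
    have hVnu : baseChangeHom (V * ((1 : B₂.X ⟶ B₂.X) ≫ V)⁻¹) u = baseChangeHom V u :=
      baseChangeHom_mul_inv_one_comp_eq V u ((one_comp_baseChangeHom_iff V u).2 hunitV)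
    -- the closed layer
    have hsec : ∀ k, u ≫ (σ₀ k).left = u ≫ (σ₀' k).left := by
      rintro (_ | _ | i)
      · exact hunitV
      · exact hunitU
      · exact (baseChange_σ_comp_baseChangeHom_iff U u lvl₁ lvl₂ i).1 (by rw [← hεU]; exact hσ i)
    obtain ⟨l₀, hl₀⟩ := (hE₀ u).1 hsec
    -- the open-and-closed layer
    have hW₁u : Set.range u.base ⊆ (W₁ : Set B) := by
      refine (hW₁ u).1 ?_
      change baseChangeHom _ u = baseChangeHom (𝟙 B₁.X) u
      rw [show baseChangeHom ((U * ((1 : B₁.X ⟶ B₁.X) ≫ U)⁻¹) ≫ (V * ((1 : B₂.X ⟶ B₂.X) ≫ V)⁻¹)) u =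
          baseChangeHom (U * ((1 : B₁.X ⟶ B₁.X) ≫ U)⁻¹) u ≫ baseChangeHom (V * ((1 : B₂.X ⟶ B₂.X) ≫ V)⁻¹) u from
          Functor.map_comp _ _ _, hUnu, hVnu, ← hεU, ← hεV, ε.hom_inv_id]
      exact ((Over.pullback u).map_id _).symm
    have hW₂u : Set.range u.base ⊆ (W₂ : Set B) := by
      refine (hW₂ u).1 ?_
      change baseChangeHom _ u = baseChangeHom (𝟙 B₂.X) u
      rw [show baseChangeHom ((V * ((1 : B₂.X ⟶ B₂.X) ≫ V)⁻¹) ≫ (U * ((1 : B₁.X ⟶ B₁.X) ≫ U)⁻¹)) u =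
          baseChangeHom (V * ((1 : B₂.X ⟶ B₂.X) ≫ V)⁻¹) u ≫ baseChangeHom (U * ((1 : B₁.X ⟶ B₁.X) ≫ U)⁻¹) u from
          Functor.map_comp _ _ _, hUnu, hVnu, ← hεU, ← hεV, ε.inv_hom_id]
      exact ((Over.pullback u).map_id _).symm
    have hW₃u : Set.range u.base ⊆ (W₃ : Set B) := by
      refine (hW₃ u).1 fun a => ?_
      change baseChangeHom (act₁ a ≫ _) u = baseChangeHom (_ ≫ act₂ a) u
      rw [show baseChangeHom (act₁ a ≫ (U * ((1 : B₁.X ⟶ B₁.X) ≫ U)⁻¹)) u =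
          baseChangeHom (act₁ a) u ≫ baseChangeHom (U * ((1 : B₁.X ⟶ B₁.X) ≫ U)⁻¹) u from Functor.map_comp _ _ _,
        show baseChangeHom ((U * ((1 : B₁.X ⟶ B₁.X) ≫ U)⁻¹) ≫ act₂ a) u =
          baseChangeHom (U * ((1 : B₁.X ⟶ B₁.X) ≫ U)⁻¹) u ≫ baseChangeHom (act₂ a) u from Functor.map_comp _ _ _,
        hUnu, ← hεU]
      exact hact a
    have hW₄u : Set.range u.base ⊆ (W₄ : Set B) := by
      refine (hW₄ u).1 ?_
      change baseChangeHom _ u = baseChangeHom lam₁ u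
      rw [show baseChangeHom ((U * ((1 : B₁.X ⟶ B₁.X) ≫ U)⁻¹) ≫ lam₂ ≫
            DualPair.dualIsogenyOver (U * ((1 : B₁.X ⟶ B₁.X) ≫ U)⁻¹) D₁ D₂) u =
          baseChangeHom (U * ((1 : B₁.X ⟶ B₁.X) ≫ U)⁻¹) u ≫ baseChangeHom lam₂ u ≫
            baseChangeHom (DualPair.dualIsogenyOver (U * ((1 : B₁.X ⟶ B₁.X) ≫ U)⁻¹) D₁ D₂) u by
          change (Over.pullback u).map _ = _
          rw [Functor.map_comp, Functor.map_comp],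
        baseChangeHom_dualIsogenyOver u _ D₁ D₂, dualIsogenyOver_congr_left (h₂ := hUu) hUnu, hUnu,
        dualIsogenyOver_congr_left (h₂ := hε) hεU.symm, ← hεU]
      exact hlam
    have hrange : Set.range l₀.base ⊆ ((ι₀ ⁻¹ᵁ W : E₀.Opens) : Set E₀) := by
      rintro _ ⟨t, rfl⟩
      change ι₀.base (l₀.base t) ∈ (W : Set B)
      have ht : ι₀.base (l₀.base t) ∈ Set.range u.base := ⟨t, by rw [← hl₀]; rfl⟩
      exact ⟨⟨⟨hW₁u ht, hW₂u ht⟩, hW₃u ht⟩, hW₄u ht⟩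
    have hrange' : Set.range l₀.base ⊆ Set.range (ι₀ ⁻¹ᵁ W).ι.base := by rwa [Scheme.Opens.range_ι]
    refine ⟨IsOpenImmersion.lift (ι₀ ⁻¹ᵁ W).ι l₀ hrange', ?_⟩
    rw [← Category.assoc, IsOpenImmersion.lift_fac, hl₀]

end Locus

end AbelianSchemeOver

end Literature.AlgebraicGeometry.AbelianSchemes

end
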